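import Summits.ResolutionOfSingularities.ResolutionOfSingularities.Theorems.NearCutWalls2
import Mathlib.RingTheory.MvPolynomial.Ideal
import Mathlib.RingTheory.Localization.FractionRing
import Mathlib.Algebra.Ring.GeomSum
import HarnessLib

/-!
# NearCut §P1–§P2 (decomp-res lens-3 g23, PRIME SHEDDING part 1/3): Taylor functoriality, injectivity of the reduced
# chart substitution modulo `(u)^s`, and the chart homomorphism `σ = translate b ∘ φ_j`

Pure additions in namespace `Summit.ResolutionOfSingularities.ResolutionOfSingularities.Theorems.NearCut`, typed
against the LANDED `NearCutWalls2` (`ChainShedding`, `multIdeal`,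
`IsolatedMult`); nothing restated.  Content = node HOME/decomp-res-lens-3/g23/NearCut.lean §P1–§P2 verbatim
(farm-checked inside the node: rc 0, 0 sorry, axioms standard).  See NODE-g23.md §2 for the paper proof.
-/

noncomputable section

open MvPolynomial Finset
open Literature.AlgebraicGeometry.Resolution
open Literature.AlgebraicGeometry.Resolution.Hauser2010
open Literature.AlgebraicGeometry.Resolution.PointBlowup
open Summit.ResolutionOfSingularities.ResolutionOfSingularities.Theses
open Summit.ResolutionOfSingularities.ResolutionOfSingularities.Theorems.TightDefectClasses
open Summit.ResolutionOfSingularities.ResolutionOfSingularities.Theorems.TightDefectStrongWalks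
open Summit.ResolutionOfSingularities.ResolutionOfSingularities.Theorems.ItineraryCutClasses
open Summit.ResolutionOfSingularities.ResolutionOfSingularities.Theorems.BoundaryLedger
open Summit.ResolutionOfSingularities.ResolutionOfSingularities.Theorems.ProximityCut
open Summit.ResolutionOfSingularities.ResolutionOfSingularities.Theorems.ConeCutAxisLaw
open Literature.AlgebraicGeometry.Resolution.WeightedBlowup
open Literature.Barriers.ResolutionOfSingularities
open Summit.ResolutionOfSingularities.ResolutionOfSingularities.Theorems.FloorCut
open Summit.ResolutionOfSingularities.ResolutionOfSingularities.Theorems.ConeCut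
open Summit.ResolutionOfSingularities.ResolutionOfSingularities.Theorems.ExitLaw (fin3_cases eq_of_le_of_degree_le)
open Summit.ResolutionOfSingularities.ResolutionOfSingularities.Theorems.ShadeCut
open Summit.ResolutionOfSingularities.ResolutionOfSingularities.Theorems.TightCut
open Summit.ResolutionOfSingularities.ResolutionOfSingularities.Theorems.HoleCut

namespace Summit.ResolutionOfSingularities.ResolutionOfSingularities.Theorems.NearCut

/-! ## §P PRIME SHEDDING — the KERNEL PROOF of `ChainShedding` (g23).

No arcs, no Cohen structure theorem, no normalisation, no valuations: the order-`s` locus is followed through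
PRIME IDEALS `P ⊇ multIdeal s G_n` of the polynomial ring contained in the ideal of the closed point ("curve
primes"), contracted DOWN the chain along the chart homomorphism `σ_n = translate b_n ∘ φ_{j_n}` (Hasse–Schmidt /
Taylor functoriality + an explicit inverse of the reduced Taylor substitution on the truncated algebra), and the
monovariant is the sum over the walls of the INTERSECTION LENGTHS `ℓ_{R/P}((R/P)/(ȳ_c))` — natural numbers by Krull's
principal ideal theorem + equidimensionality of affine domains, additive in products, and non-increasing under the
birational extension `R/σ⁻¹P' ↪ R/P'` by the Krull–Akizuki lemma. -/

/-! ### §P1 Taylor functoriality of an algebra endomorphism and injectivity of the reduced chart substitution -/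

section Taylor

variable {ι : Type*} {K : Type*} [CommRing K]

/-- The base change `Θ_φ` of the Taylor algebra along an algebra endomorphism `φ`: coefficients `g ↦ φ g`, Taylor
variables `u_i ↦ φ_i(x + u) − φ_i(x)`. [folklore] -/
noncomputable def taylorMap (φ : MvPolynomial ι K →ₐ[K] MvPolynomial ι K) :
    MvPolynomial ι (MvPolynomial ι K) →+* MvPolynomial ι (MvPolynomial ι K) :=
  eval₂Hom (C.comp (φ : MvPolynomial ι K →+* MvPolynomial ι K))
    (fun i => taylor K (φ (X i)) - C (φ (X i)))

/-- **Chain rule for the Taylor morphism**: `f(φ(x + u)) = f(φ(x) + (φ(x+u) − φ(x)))`, i.e.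
`taylor (φ f) = Θ_φ (taylor f)`. [folklore] -/
theorem taylor_comp_algHom (φ : MvPolynomial ι K →ₐ[K] MvPolynomial ι K) (f : MvPolynomial ι K) :
    taylor K (φ f) = taylorMap φ (taylor K f) := by
  have key : (taylor K (σ := ι)).toRingHom.comp (φ : MvPolynomial ι K →+* MvPolynomial ι K) =
      (taylorMap φ).comp (taylor K (σ := ι)).toRingHom := by
    refine MvPolynomial.ringHom_ext (fun c => ?_) (fun i => ?_)
    · simp [taylorMap]
    · simp [taylorMap]
  exact RingHom.congr_fun key f

/-- Reduction of `Θ_φ` along a ring map `π : K[x] → L` of the coefficients: it becomes the `L`-algebra substitution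
`u_i ↦ π(φ_i(x+u) − φ_i(x))` applied after reducing the coefficients along `π ∘ φ`. [folklore] -/
theorem map_taylorMap {L : Type*} [CommRing L] (φ : MvPolynomial ι K →ₐ[K] MvPolynomial ι K)
    (π : MvPolynomial ι K →+* L) (F : MvPolynomial ι (MvPolynomial ι K)) :
    MvPolynomial.map π (taylorMap φ F) =
      aeval (fun i => MvPolynomial.map π (taylor K (φ (X i)) - C (φ (X i))))
        (MvPolynomial.map (π.comp (φ : MvPolynomial ι K →+* MvPolynomial ι K)) F) := by
  have key : (MvPolynomial.map π).comp (taylorMap φ) =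
      (aeval (R := L) (fun i => MvPolynomial.map π (taylor K (φ (X i)) - C (φ (X i))))).toRingHom.comp
        (MvPolynomial.map (π.comp (φ : MvPolynomial ι K →+* MvPolynomial ι K))) := by
    refine MvPolynomial.ringHom_ext (fun g => ?_) (fun i => ?_)
    · simp [taylorMap]
    · simp [taylorMap]
  exact RingHom.congr_fun key F

/-- **Injectivity of the reduced chart substitution on the truncated Taylor algebra.**  Over a field `L`, the
substitution `u_j ↦ u_j`, `u_i ↦ η u_i + c_i u_j + u_j u_i` (`i ≠ j`, `η ≠ 0`) — the reduction of the Taylor base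
change of the chart map `y_j ↦ y_j`, `y_i ↦ y_j (y_i + b_i)` modulo a prime not containing `y_j` — detects the ideal
`(u)^s`: if the substituted polynomial lies in `(u)^s` then so does the polynomial.  Proof: an explicit left inverse
on `L[u]/(u)^s`, `u_i ↦ (u_i − c_i u_j) η⁻¹ Σ_{k<s} (−u_j/η)^k` (geometric series for `(η + u_j)⁻¹`). [new;
folklore] [folklore] -/
theorem mem_pow_idealOfVars_of_aeval_mem {L : Type*} [Field L] [DecidableEq ι] (j : ι) {η : L} (hη : η ≠ 0)
    (c : ι → L) (s : ℕ) (h : MvPolynomial ι L)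
    (H : aeval (fun i => if i = j then (X j : MvPolynomial ι L) else C η * X i + C (c i) * X j + X j * X i) h ∈
      idealOfVars ι L ^ s) :
    h ∈ idealOfVars ι L ^ s := by
  set I : Ideal (MvPolynomial ι L) := idealOfVars ι L with hI
  set mk : MvPolynomial ι L →+* MvPolynomial ι L ⧸ I ^ s := Ideal.Quotient.mk (I ^ s) with hmk
  set y : MvPolynomial ι L ⧸ I ^ s := -(mk (C η⁻¹) * mk (X j)) with hy
  set v : MvPolynomial ι L ⧸ I ^ s := ∑ k ∈ Finset.range s, y ^ k with hv
  -- `u_j^s = 0` in the truncated algebra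
  have hXs : mk (X j) ^ s = 0 := by
    rw [← map_pow, hmk, Ideal.Quotient.eq_zero_iff_mem]
    exact Ideal.pow_mem_pow (Ideal.subset_span (Set.mem_range_self j)) s
  have hys : y ^ s = 0 := by
    have : y = mk (X j) * (-(mk (C η⁻¹))) := by rw [hy]; ring
    rw [this, mul_pow, hXs, zero_mul]
  have hCC : mk (C η) * mk (C η⁻¹) = 1 := by
    rw [← map_mul, ← C_mul, mul_inv_cancel₀ hη, C_1, map_one]
  -- `(η + u_j) · η⁻¹ v = 1`
  have hunit : (mk (C η) + mk (X j)) * (mk (C η⁻¹) * v) = 1 := by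
    have h1 : (mk (C η) + mk (X j)) * mk (C η⁻¹) = 1 - y := by
      rw [hy]; linear_combination hCC
    calc (mk (C η) + mk (X j)) * (mk (C η⁻¹) * v)
        = ((mk (C η) + mk (X j)) * mk (C η⁻¹)) * v := by ring
      _ = (1 - y) * ∑ k ∈ Finset.range s, y ^ k := by rw [h1]
      _ = 1 - y ^ s := mul_neg_geom_sum y s
      _ = 1 := by rw [hys, sub_zero]
  -- the left inverse `Ψ`
  set Ψ : MvPolynomial ι L →ₐ[L] MvPolynomial ι L ⧸ I ^ s :=
    aeval (fun i => if i = j then mk (X j) else (mk (X i) - mk (C (c i)) * mk (X j)) * (mk (C η⁻¹) * v)) with hΨ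
  have hΨX : ∀ i, Ψ (X i) = if i = j then mk (X j) else (mk (X i) - mk (C (c i)) * mk (X j)) * (mk (C η⁻¹) * v) :=
    fun i => by rw [hΨ, aeval_X]
  have hΨC : ∀ r : L, Ψ (C r) = mk (C r) := fun r => by
    rw [hΨ, aeval_C]; rfl
  set θ : MvPolynomial ι L →ₐ[L] MvPolynomial ι L :=
    aeval (fun i => if i = j then (X j : MvPolynomial ι L) else C η * X i + C (c i) * X j + X j * X i) with hθ
  -- `Ψ ∘ θ = mk`
  have hcomp : Ψ.toRingHom.comp θ.toRingHom = mk := by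
    refine MvPolynomial.ringHom_ext (fun r => ?_) (fun i => ?_)
    · simp only [RingHom.coe_comp, AlgHom.toRingHom_eq_coe, RingHom.coe_coe, Function.comp_apply, hθ, aeval_C,
        algebraMap_eq]
      exact hΨC r
    · simp only [RingHom.coe_comp, AlgHom.toRingHom_eq_coe, RingHom.coe_coe, Function.comp_apply, hθ, aeval_X]
      by_cases hij : i = j
      · subst hij
        rw [if_pos rfl, hΨX, if_pos rfl]
      · rw [if_neg hij, map_add, map_add, map_mul, map_mul, map_mul, hΨC, hΨC, hΨX i, if_neg hij, hΨX j,
          if_pos rfl]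
        have hc : mk (C (c i) * X j) = mk (C (c i)) * mk (X j) := map_mul _ _ _
        linear_combination (mk (X i) - mk (C (c i)) * mk (X j)) * hunit
  -- `Ψ` kills `(u)^s`
  have hΨI : Ideal.map Ψ I ≤ Ideal.map mk I := by
    refine Ideal.map_le_iff_le_comap.mpr (Ideal.span_le.mpr ?_)
    rintro _ ⟨i, rfl⟩
    rw [SetLike.mem_coe, Ideal.mem_comap, hΨX]
    split_ifs with hij
    · exact Ideal.mem_map_of_mem _ (Ideal.subset_span ⟨j, rfl⟩)
    · exact Ideal.mul_mem_right _ _ (Ideal.sub_mem _ (Ideal.mem_map_of_mem _ (Ideal.subset_span ⟨i, rfl⟩))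
        (Ideal.mul_mem_left _ _ (Ideal.mem_map_of_mem _ (Ideal.subset_span ⟨j, rfl⟩))))
  have hΨIs : Ideal.map Ψ (I ^ s) = ⊥ := by
    rw [Ideal.map_pow, eq_bot_iff]
    calc Ideal.map Ψ I ^ s ≤ Ideal.map mk I ^ s := Ideal.pow_right_mono hΨI s
      _ = ⊥ := by rw [← Ideal.map_pow, hmk, Ideal.map_quotient_self]
      _ ≤ ⊥ := le_rfl
  -- conclusion
  have hθh : Ψ (θ h) = mk h := by
    have := RingHom.congr_fun hcomp h
    simpa using this
  have hzero : Ψ (θ h) = 0 := by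
    have : Ψ (θ h) ∈ Ideal.map Ψ (I ^ s) := Ideal.mem_map_of_mem _ H
    rwa [hΨIs, Ideal.mem_bot] at this
  rw [hθh, hmk, Ideal.Quotient.eq_zero_iff_mem] at hzero
  exact hzero

end Taylor

end Summit.ResolutionOfSingularities.ResolutionOfSingularities.Theorems.NearCut

namespace Summit.ResolutionOfSingularities.ResolutionOfSingularities.Theorems.NearCut

/-! ### §P2 The chart homomorphism `σ = translate b ∘ φ_j` and the downward functoriality of `multIdeal` -/

section Chart

variable {K : Type} [Field K]

/-- The chart homomorphism of one step of the chain: the `y_j`-chart substitution `y_j ↦ y_j`, `y_i ↦ y_j y_i`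
followed by the translation `y ↦ y + b`.  [Hauser2010 §5; CJS2270 §5] -/
noncomputable def chartHom (j : Fin 3) (b : Fin 3 → K) : MvPolynomial (Fin 3) K →ₐ[K] MvPolynomial (Fin 3) K :=
  (aeval fun i => (X i + C (b i) : MvPolynomial (Fin 3) K)).comp
    (aeval fun i => if i = j then (X j : MvPolynomial (Fin 3) K) else X j * X i)

/-- `chartHom_X_self`: Auxiliary step of the lens-3 g23 §P prime-shedding calculus, VERBATIM from the lens file
tree/NearCutChartTaylor.lean (see the module docstring); the statement is its type. [folklore] -/
theorem chartHom_X_self {j : Fin 3} {b : Fin 3 → K} (hb : b j = 0) : chartHom j b (X j) = X j := by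
  simp [chartHom, hb]

/-- `chartHom_X_of_ne`: Auxiliary step of the lens-3 g23 §P prime-shedding calculus, VERBATIM from the lens file
tree/NearCutChartTaylor.lean (see the module docstring); the statement is its type. [folklore] -/
theorem chartHom_X_of_ne {j : Fin 3} {b : Fin 3 → K} (hb : b j = 0) {i : Fin 3} (hij : i ≠ j) :
    chartHom j b (X i) = X j * (X i + C (b i)) := by
  simp [chartHom, hb, hij]

/-- `σ G = y_j^s · G'` where `G' = translate b (chartTransform s j G)` is the next member of the chain.
[Hauser2010 §5] [folklore] -/
theorem chartHom_apply_eq {j : Fin 3} {b : Fin 3 → K} (hb : b j = 0) {s : ℕ} (G : MvPolynomial (Fin 3) K)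
    (hs : (s : ℕ∞) ≤ ordZero G) :
    chartHom j b G = X j ^ s * PointBlowup.translate b (chartTransform s j G) := by
  have h1 := X_pow_mul_chartTransform j hs
  unfold chartHom
  rw [AlgHom.comp_apply, ← h1, map_mul, map_pow, aeval_X, hb, C_0, add_zero]
  rfl

/-- The chart homomorphism preserves the constant coefficient (it fixes the closed point). [folklore] -/
theorem constantCoeff_chartHom {j : Fin 3} {b : Fin 3 → K} (hb : b j = 0) (f : MvPolynomial (Fin 3) K) :
    constantCoeff (chartHom j b f) = constantCoeff f := by
  have key : (constantCoeff : MvPolynomial (Fin 3) K →+* K).comp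
      (chartHom j b : MvPolynomial (Fin 3) K →+* MvPolynomial (Fin 3) K) = constantCoeff := by
    refine MvPolynomial.ringHom_ext (fun r => ?_) (fun i => ?_)
    · simp
    · by_cases hij : i = j
      · subst hij
        simp only [RingHom.coe_comp, RingHom.coe_coe, Function.comp_apply, chartHom_X_self hb]
      · simp only [RingHom.coe_comp, RingHom.coe_coe, Function.comp_apply, chartHom_X_of_ne hb hij]
        simp
  exact RingHom.congr_fun key f

/-- Denominators: every polynomial becomes an image of `σ` after multiplication by a power of `y_j`
(`K[y] ⊆ σ(K[y])[1/y_j]`, the chart being an isomorphism away from `y_j = 0`). [folklore] -/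
theorem exists_X_pow_mul_eq_chartHom {j : Fin 3} {b : Fin 3 → K} (hb : b j = 0) (f : MvPolynomial (Fin 3) K) :
    ∃ (e : ℕ) (g : MvPolynomial (Fin 3) K), X j ^ e * f = chartHom j b g := by
  induction f using MvPolynomial.induction_on with
  | C r => exact ⟨0, C r, by simp [chartHom]⟩
  | add f g hf hg =>
    obtain ⟨e₁, f₁, h₁⟩ := hf
    obtain ⟨e₂, g₁, h₂⟩ := hg
    refine ⟨e₁ + e₂, X j ^ e₂ * f₁ + X j ^ e₁ * g₁, ?_⟩
    rw [map_add, map_mul, map_mul, map_pow, map_pow, chartHom_X_self hb, ← h₁, ← h₂]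
    ring
  | mul_X f i hf =>
    obtain ⟨e, g, h⟩ := hf
    by_cases hij : i = j
    · subst hij
      refine ⟨e, g * X i, ?_⟩
      rw [map_mul, chartHom_X_self hb, ← h]
      ring
    · refine ⟨e + 1, g * (X i - C (b i) * X j), ?_⟩
      rw [map_mul, map_sub, map_mul, chartHom_X_self hb, chartHom_X_of_ne hb hij, ← h, MvPolynomial.algHom_C, MvPolynomial.algebraMap_eq]
      ring
end Chart

end Summit.ResolutionOfSingularities.ResolutionOfSingularities.Theorems.NearCut
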